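import Literature.MathematicalPhysics.QuantumLattice.FermiRG.Salmhofer1998NormBoundProof
import Literature.MathematicalPhysics.QuantumLattice.FermiRG.Salmhofer1998GramProof
import HarnessLib

/-!
# Salmhofer 1998, Theorem 1 (power counting for the truncated flow) — PROOF

M. Salmhofer, *Continuous renormalization for fermions and Fermi liquid theory*, Commun. Math. Phys.
**194** (1998) 249–295 = arXiv:cond-mat/9706188 [Salmhofer1998], Theorem 1 (render
`paper:arxiv-cond-mat_9706188` p.15 L12–47, proof L48–85).  This file DISCHARGES the named fact
`Literature.MathematicalPhysics.QuantumLattice.FermiRG.Salmhofer1998.TruncatedPowerCounting` (licence F-081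
of the gate-hubbard-kl wave, typed by t7 in `Salmhofer1998Sec2.lean`):

`theorem TruncatedPowerCounting_holds : TruncatedPowerCounting`.

We follow the printed proof (p.15 L48–85): "Induction in `r` … The case `r = 1` is trivial.  Let `r ≥ 2`
… By Lemma 2, (4.13) holds with `A_i(t) = Δ₁^{i-1} e^{-t(i-1)}`.  Thus [Lemma 1]
`‖Q̃_{mr}(t)‖ ≤ Δ₂ ∫dκ̃ i² Δ₁^{i-1} e^{-t(i-2)} ‖G̃_{m₁r₁}(t)‖ ‖G̃_{m₂r₂}(t)‖`.  By the inductive hypothesis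
and `m₁ + m₂ - 2i = m`, `‖·‖` of the right hand side of the integral equation is bounded by
`‖G_{mr}(0)‖ + ∫dκ̃ i² Δ₁^{i-1} Δ₂ γ_{m₁r₁} γ_{m₂r₂} ½ ∫_0^t ds e^{s(m/2-2)}`", and the three elementary
estimates `½∫_0^t e^{s(m/2-2)} ≤ (3/m) e^{t(m/2-2)}` (`m ≥ 6`), `½ t ≤ (3/4)(1+t)` (`m = 4`),
`½ ∫_0^t e^{-s} ≤ 3/2` (`m = 2`).  Lemma 1 is the tree theorem `DeterminantNormBound_holds`
(`Salmhofer1998NormBoundProof.lean`), Lemma 2 is `CovarianceGramBound_holds` (`Salmhofer1998GramProof.lean`).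

What the printed proof leaves implicit and the Lean proof supplies: "`‖·‖` of `½ 𝔸_m ∫_0^t ds Q̃(s)` is at
most `½ ∫_0^t ds ‖Q̃(s)‖`" needs `s ↦ Q̃_{mr}(s | X)` integrable on `[0,t]`; this is carried through the
induction (`D_t` is continuous being differentiable, `Ḋ_t` is measurable as a derivative and bounded by
(4.15), and `s ↦ G̃_{m'r'}(s | X)` is continuous on `[0,∞)` for `r' < r` by the integral equation itself).
The induction is run uniformly in `r` (for `r ≤ 1` the `κ`-sum is empty, which is the "trivial" base case).

No new definition of mathematical content (`gammaTr` names the `let` of t7's `IsTruncatedGamma`), no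
`sorry`, no new named fact: net fact debt `-1`.
-/

noncomputable section

open Finset MeasureTheory Set

namespace Literature.MathematicalPhysics.QuantumLattice.FermiRG

namespace Salmhofer1998

/-! ### More on the `κ`-sum: monotonicity, scaling, congruence on the support -/

section KappaMore

/-- Monotonicity of `Re ∫dκ_{mr}` in a real integrand, on the support of `κ` inside `𝓜`.
[cite: Salmhofer1998, Proposition 2 (p.12 L81–98)] -/
theorem re_kappaSum_mono (mbar : ℕ → ℕ) (m r : ℕ) (B B' : ℕ → ℕ → ℕ → ℕ → ℕ → ℝ)
    (h : ∀ r₁ m₁ m₂ i, r₁ ∈ Finset.Icc 1 (r - 1) → m₁ ∈ Finset.Icc 1 (mbar r₁) →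
      m₂ ∈ Finset.Icc 1 (mbar (r - r₁)) → MIndex mbar r₁ (r - r₁) m m₁ m₂ i = true → i ≤ m₁ → i ≤ m₂ →
        B r₁ m₁ (r - r₁) m₂ i ≤ B' r₁ m₁ (r - r₁) m₂ i) :
    (kappaSum mbar m r fun r₁ m₁ r₂ m₂ i => (B r₁ m₁ r₂ m₂ i : ℂ)).re ≤
      (kappaSum mbar m r fun r₁ m₁ r₂ m₂ i => (B' r₁ m₁ r₂ m₂ i : ℂ)).re := by
  rw [re_kappaSum_ofReal, re_kappaSum_ofReal]
  refine Finset.sum_le_sum fun r₁ hr₁ => Finset.sum_le_sum fun m₁ hm₁ =>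
    Finset.sum_le_sum fun m₂ hm₂ => Finset.sum_le_sum fun i _ => ?_
  by_cases hM : MIndex mbar r₁ (r - r₁) m m₁ m₂ i = true
  · simp only [hM, if_true]
    by_cases hκ : kappa m₁ m₂ i = 0
    · simp [hκ]
    · have hle := le_of_kappa_ne_zero hκ
      exact mul_le_mul_of_nonneg_left (h r₁ m₁ m₂ i hr₁ hm₁ hm₂ hM hle.1 hle.2) (Nat.cast_nonneg _)
  · simp [hM]

/-- Congruence of `Re ∫dκ_{mr}` on the support of `κ` inside `𝓜`. [cite: Salmhofer1998, Proposition 2 (p.12 L81–98)] -/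
theorem re_kappaSum_congr (mbar : ℕ → ℕ) (m r : ℕ) (B B' : ℕ → ℕ → ℕ → ℕ → ℕ → ℝ)
    (h : ∀ r₁ m₁ m₂ i, r₁ ∈ Finset.Icc 1 (r - 1) → m₁ ∈ Finset.Icc 1 (mbar r₁) →
      m₂ ∈ Finset.Icc 1 (mbar (r - r₁)) → MIndex mbar r₁ (r - r₁) m m₁ m₂ i = true → i ≤ m₁ → i ≤ m₂ →
        B r₁ m₁ (r - r₁) m₂ i = B' r₁ m₁ (r - r₁) m₂ i) :
    (kappaSum mbar m r fun r₁ m₁ r₂ m₂ i => (B r₁ m₁ r₂ m₂ i : ℂ)).re =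
      (kappaSum mbar m r fun r₁ m₁ r₂ m₂ i => (B' r₁ m₁ r₂ m₂ i : ℂ)).re :=
  le_antisymm
    (re_kappaSum_mono mbar m r B B' fun r₁ m₁ m₂ i h1 h2 h3 h4 h5 h6 => (h r₁ m₁ m₂ i h1 h2 h3 h4 h5 h6).le)
    (re_kappaSum_mono mbar m r B' B fun r₁ m₁ m₂ i h1 h2 h3 h4 h5 h6 => (h r₁ m₁ m₂ i h1 h2 h3 h4 h5 h6).ge)

/-- Scalars pull out of `Re ∫dκ_{mr}`. [cite: Salmhofer1998, Proposition 2 (p.12 L81–98)] -/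
theorem re_kappaSum_const_mul (mbar : ℕ → ℕ) (m r : ℕ) (c : ℝ) (B : ℕ → ℕ → ℕ → ℕ → ℕ → ℝ) :
    (kappaSum mbar m r fun r₁ m₁ r₂ m₂ i => ((c * B r₁ m₁ r₂ m₂ i : ℝ) : ℂ)).re =
      c * (kappaSum mbar m r fun r₁ m₁ r₂ m₂ i => (B r₁ m₁ r₂ m₂ i : ℂ)).re := by
  rw [re_kappaSum_ofReal, re_kappaSum_ofReal]
  simp only [Finset.mul_sum]
  refine Finset.sum_congr rfl fun r₁ _ => Finset.sum_congr rfl fun m₁ _ =>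
    Finset.sum_congr rfl fun m₂ _ => Finset.sum_congr rfl fun i _ => ?_
  split_ifs
  · ring
  · simp

/-- `Re ∫dκ_{mr}` of an integrand nonnegative on the support is nonnegative.
[cite: Salmhofer1998, Proposition 2 (p.12 L81–98)] -/
theorem re_kappaSum_nonneg (mbar : ℕ → ℕ) (m r : ℕ) (B : ℕ → ℕ → ℕ → ℕ → ℕ → ℝ)
    (h : ∀ r₁ m₁ m₂ i, r₁ ∈ Finset.Icc 1 (r - 1) → m₁ ∈ Finset.Icc 1 (mbar r₁) →
      m₂ ∈ Finset.Icc 1 (mbar (r - r₁)) → MIndex mbar r₁ (r - r₁) m m₁ m₂ i = true → i ≤ m₁ → i ≤ m₂ →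
        0 ≤ B r₁ m₁ (r - r₁) m₂ i) :
    0 ≤ (kappaSum mbar m r fun r₁ m₁ r₂ m₂ i => (B r₁ m₁ r₂ m₂ i : ℂ)).re := by
  have h0 : (kappaSum mbar m r fun _ _ _ _ _ => ((0 : ℝ) : ℂ)).re = 0 := by
    rw [re_kappaSum_ofReal]; simp
  rw [← h0]
  exact re_kappaSum_mono mbar m r (fun _ _ _ _ _ => 0) B h

end KappaMore

/-! ### Slices under permutations; the antisymmetrisation does not increase the norm -/

section PermSlices

variable {Γ : Type*} [Fintype Γ] [DecidableEq Γ]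

/-- A slice of `X ↦ F(X ∘ π)` is a slice of `F` (at the leg `π⁻¹ p`). [cite: Salmhofer1998, §3.2 (p.12 L116–122)] -/
theorem sliceSum_comp_perm {n : ℕ} (F : (Fin n → Γ) → ℂ) (π : Equiv.Perm (Fin n)) (p : Fin n) (x : Γ) :
    sliceSum (fun X => F (X ∘ π)) p x = sliceSum F (π.symm p) x := by
  unfold sliceSum
  refine Finset.sum_nbij' (fun X => X ∘ π) (fun X' => X' ∘ π.symm) ?_ ?_ ?_ ?_ ?_
  · intro X hX
    simp only [Finset.mem_filter, Finset.mem_univ, true_and] at hX ⊢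
    simpa using hX
  · intro X hX
    simp only [Finset.mem_filter, Finset.mem_univ, true_and] at hX ⊢
    simpa using hX
  · intro X _
    funext j
    simp
  · intro X _
    funext j
    simp
  · intro X _
    rfl

omit [Fintype Γ] [DecidableEq Γ] in
/-- `|(𝔸_m f)(X)| ≤ (1/m!) Σ_π |f(X ∘ π)|`. [cite: Salmhofer1998, §3.2 (p.12 L116–122)] -/
theorem norm_antisym_le {m : ℕ} (f : (Fin m → Γ) → ℂ) (X : Fin m → Γ) :
    ‖antisym f X‖ ≤ (m.factorial : ℝ)⁻¹ * ∑ π : Equiv.Perm (Fin m), ‖f (X ∘ π)‖ := by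
  unfold antisym
  rw [norm_smul, Real.norm_of_nonneg (inv_nonneg.mpr (Nat.cast_nonneg _))]
  refine mul_le_mul_of_nonneg_left ((norm_sum_le _ _).trans (Finset.sum_le_sum fun π _ => ?_))
    (inv_nonneg.mpr (Nat.cast_nonneg _))
  rw [norm_mul]
  have h1 : ‖((Equiv.Perm.sign π : ℤ) : ℂ)‖ = 1 := by
    rcases Int.units_eq_one_or (Equiv.Perm.sign π) with h | h <;> simp [h]
  rw [h1, one_mul]

/-- On an empty index set every kernel of positive arity has norm `0`. [folklore] -/
private theorem kernelNorm_of_isEmpty' [IsEmpty Γ] (ε : ℝ) {n : ℕ} (K : (Fin (n + 1) → Γ) → ℂ) :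
    kernelNorm ε (n + 1) K = 0 := by
  rw [kernelNorm_succ]
  simp

/-- Finite sums of interval-integrable functions, pointwise form. [folklore] -/
private theorem ii_finset_sum {ι E : Type*} [NormedAddCommGroup E] (S : Finset ι) {f : ι → ℝ → E}
    {a b : ℝ} (h : ∀ i ∈ S, IntervalIntegrable (f i) volume a b) :
    IntervalIntegrable (fun s => ∑ i ∈ S, f i s) volume a b := by
  have := IntervalIntegrable.sum S h
  rwa [Finset.sum_fn] at this

/-- **The norm of one step of the integral equation** (p.15 L62–70: "`‖·‖` of the right hand side of
the integral equation is bounded by `‖G_{mr}(0)‖ + ½ ∫_0^t ds` (bound of `‖Q(s)‖`)"): if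
`K = K₀ + ½ 𝔸 ∫_0^t ds q(s)` pointwise, each `s ↦ q(s | Y)` is integrable on `[0,t]`, and every weighted
slice of `q(s)` is `≤ b(s)` on `[0,t]`, then `‖K‖ ≤ ‖K₀‖ + ½ ∫_0^t b`.
[cite: Salmhofer1998, Theorem 1 proof (p.15 L62–70)] -/
theorem kernelNorm_step_le {ε : ℝ} (hε : 0 < ε) {n : ℕ} (K K0 : (Fin (n + 1) → Γ) → ℂ)
    (q : ℝ → (Fin (n + 1) → Γ) → ℂ) (b : ℝ → ℝ) {t : ℝ} (ht : 0 ≤ t)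
    (hK : ∀ X, K X = K0 X + (2 : ℂ)⁻¹ * antisym (fun Y => ∫ s in (0 : ℝ)..t, q s Y) X)
    (hq : ∀ Y, IntervalIntegrable (fun s => q s Y) volume 0 t)
    (hb : IntervalIntegrable b volume 0 t) (hb0 : ∀ s ∈ Set.Icc (0 : ℝ) t, 0 ≤ b s)
    (hqb : ∀ s ∈ Set.Icc (0 : ℝ) t, ∀ (p : Fin (n + 1)) (x : Γ), ε ^ n * sliceSum (q s) p x ≤ b s) :
    kernelNorm ε (n + 1) K ≤ kernelNorm ε (n + 1) K0 + 2⁻¹ * ∫ s in (0 : ℝ)..t, b s := by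
  have hK0 : 0 ≤ kernelNorm ε (n + 1) K0 := kernelNorm_nonneg hε.le _ _
  rcases isEmpty_or_nonempty Γ with hΓ | hΓ
  · rw [kernelNorm_of_isEmpty']
    have hb0' : 0 ≤ ∫ s in (0 : ℝ)..t, b s := intervalIntegral.integral_nonneg ht hb0
    positivity
  refine kernelNorm_le_of_sliceSum_le ε K fun p x => ?_
  set S := Finset.univ.filter (fun X : Fin (n + 1) → Γ => X p = x) with hS
  -- the integral of the norm, slice by slice
  have hperm : ∀ π : Equiv.Perm (Fin (n + 1)),
      ε ^ n * ∑ X ∈ S, ∫ s in (0 : ℝ)..t, ‖q s (X ∘ π)‖ ≤ ∫ s in (0 : ℝ)..t, b s := by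
    intro π
    have hint : ∀ X ∈ S, IntervalIntegrable (fun s => ‖q s (X ∘ π)‖) volume 0 t :=
      fun X _ => (hq (X ∘ π)).norm
    have hI : IntervalIntegrable (fun s => ε ^ n * ∑ X ∈ S, ‖q s (X ∘ π)‖) volume 0 t :=
      (ii_finset_sum S hint).const_mul (ε ^ n)
    rw [← intervalIntegral.integral_finsetSum hint, ← intervalIntegral.integral_const_mul]
    refine intervalIntegral.integral_mono_on ht hI hb fun s hs => ?_
    have := hqb s hs (π.symm p) x
    rw [← sliceSum_comp_perm (q s) π p x] at this
    simpa [sliceSum, hS] using this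
  unfold sliceSum
  rw [← hS]
  calc ε ^ n * ∑ X ∈ S, ‖K X‖
      ≤ ε ^ n * ∑ X ∈ S, (‖K0 X‖ + 2⁻¹ * (((n + 1).factorial : ℝ)⁻¹ *
          ∑ π : Equiv.Perm (Fin (n + 1)), ∫ s in (0 : ℝ)..t, ‖q s (X ∘ π)‖)) := by
        refine mul_le_mul_of_nonneg_left (Finset.sum_le_sum fun X _ => ?_) (pow_nonneg hε.le n)
        rw [hK X]
        refine (norm_add_le _ _).trans (add_le_add le_rfl ?_)
        rw [norm_mul, norm_inv, Complex.norm_ofNat]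
        refine mul_le_mul_of_nonneg_left ((norm_antisym_le _ X).trans
          (mul_le_mul_of_nonneg_left (Finset.sum_le_sum fun π _ =>
            intervalIntegral.norm_integral_le_integral_norm ht) (inv_nonneg.mpr (Nat.cast_nonneg _))))
          (by norm_num)
    _ = ε ^ n * ∑ X ∈ S, ‖K0 X‖ + 2⁻¹ * (((n + 1).factorial : ℝ)⁻¹ *
          ∑ π : Equiv.Perm (Fin (n + 1)), (ε ^ n * ∑ X ∈ S, ∫ s in (0 : ℝ)..t, ‖q s (X ∘ π)‖)) := by
        rw [Finset.sum_add_distrib, mul_add, ← Finset.mul_sum, ← Finset.mul_sum, Finset.sum_comm]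
        simp only [Finset.mul_sum]
        congr 1
        refine Finset.sum_congr rfl fun π _ => Finset.sum_congr rfl fun X _ => ?_
        ring
    _ ≤ kernelNorm ε (n + 1) K0 + 2⁻¹ * (((n + 1).factorial : ℝ)⁻¹ *
          ∑ _π : Equiv.Perm (Fin (n + 1)), ∫ s in (0 : ℝ)..t, b s) := by
        refine add_le_add (mul_sliceSum_le_kernelNorm ε K0 p x) ?_
        refine mul_le_mul_of_nonneg_left (mul_le_mul_of_nonneg_left (Finset.sum_le_sum fun π _ => hperm π)
          (inv_nonneg.mpr (Nat.cast_nonneg _))) (by norm_num)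
    _ = kernelNorm ε (n + 1) K0 + 2⁻¹ * ∫ s in (0 : ℝ)..t, b s := by
        have hf : (((n + 1).factorial : ℕ) : ℝ) ≠ 0 := Nat.cast_ne_zero.mpr (Nat.factorial_ne_zero _)
        rw [Finset.sum_const, Finset.card_univ, Fintype.card_perm, Fintype.card_fin, nsmul_eq_mul,
          ← mul_assoc ((((n + 1).factorial : ℕ) : ℝ)⁻¹), inv_mul_cancel₀ hf, one_mul]

end PermSlices

/-! ### The elementary `t`-integral -/

/-- `∫_0^t e^{sa} ds = (e^{ta} - 1)/a` for `a ≠ 0`. [folklore] -/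
private theorem integral_exp_mul {a : ℝ} (ha : a ≠ 0) (t : ℝ) :
    ∫ s in (0 : ℝ)..t, Real.exp (s * a) = (Real.exp (t * a) - 1) / a := by
  have hderiv : ∀ s ∈ Set.uIcc (0 : ℝ) t,
      HasDerivAt (fun u : ℝ => Real.exp (u * a) / a) (Real.exp (s * a)) s := by
    intro s _
    have h1 : HasDerivAt (fun u : ℝ => u * a) a s := by simpa using (hasDerivAt_id s).mul_const a
    have h3 := h1.exp.div_const a
    rwa [mul_div_assoc, div_self ha, mul_one] at h3
  rw [intervalIntegral.integral_eq_sub_of_hasDerivAt hderiv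
    ((Real.continuous_exp.comp (continuous_id.mul continuous_const)).intervalIntegrable _ _)]
  simp [sub_div]

/-! ### The frozen factors `truncFactor` and the constants `γtr` of (4.17) -/

section Trunc

variable {Γ : Type*} [Fintype Γ] [DecidableEq Γ]

omit [Fintype Γ] [DecidableEq Γ] in
/-- Below four legs the frozen factor vanishes. [cite: Salmhofer1998, Theorem 1 (p.15 L26–29)] -/
theorem truncFactor_apply_of_lt (G : KernelFamily Γ) {m : ℕ} (hm : m < 4) (r : ℕ) (t : ℝ)
    (X : Fin m → Γ) : truncFactor G m r t X = 0 := by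
  have h4 : m ≠ 4 := by omega
  simp [truncFactor, h4, hm]

omit [Fintype Γ] [DecidableEq Γ] in
/-- The four-legged frozen factor is `v δ_{r,1}`, `v = G_{4,1}(0)`. [cite: Salmhofer1998, Theorem 1 (p.15 L26–29)] -/
theorem truncFactor_apply_four (G : KernelFamily Γ) (r : ℕ) (t : ℝ) (X : Fin 4 → Γ) :
    truncFactor G 4 r t X = if r = 1 then G 4 1 0 X else 0 := by
  unfold truncFactor
  rw [dif_pos rfl]
  rfl

omit [Fintype Γ] [DecidableEq Γ] in
/-- Above four legs the frozen factor is the Green function itself. [cite: Salmhofer1998, Theorem 1 (p.15 L26–29)] -/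
theorem truncFactor_apply_of_gt (G : KernelFamily Γ) {m : ℕ} (hm : 4 < m) (r : ℕ) (t : ℝ)
    (X : Fin m → Γ) : truncFactor G m r t X = G m r t X := by
  have h4 : m ≠ 4 := by omega
  have hlt : ¬ m < 4 := by omega
  simp [truncFactor, h4, hlt]

/-- The constants `γ̃_{m r}` fed into the truncated recursion (4.17): `0` below four legs, `‖v‖ δ_{r,1}` at
four legs, `γ_{mr}` above (this is the `let` of t7's `IsTruncatedGamma`, given a name).
[cite: Salmhofer1998, Theorem 1 (4.17) (p.15 L41–47)] -/
def gammaTr (ε : ℝ) (G0 : (m : ℕ) → ℕ → (Fin m → Γ) → ℂ) (γ : ℕ → ℕ → ℝ) (m r : ℕ) : ℝ :=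
  if m < 4 then 0 else if m = 4 then (if r = 1 then sNorm ε (G0 4 1) else 0) else γ m r

/-- `IsTruncatedGamma` unfolded with `gammaTr` (definitional). [cite: Salmhofer1998, Theorem 1 (4.17) (p.15 L41–47)] -/
theorem isTruncatedGamma_iff (ε : ℝ) (mbar : ℕ → ℕ) (G0 : (m : ℕ) → ℕ → (Fin m → Γ) → ℂ) (Δ₁ Δ₂ : ℝ)
    (γ : ℕ → ℕ → ℝ) :
    IsTruncatedGamma ε mbar G0 Δ₁ Δ₂ γ ↔ ∀ m r : ℕ, γ m r = sNorm ε (G0 m r) +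
      3 * Δ₂ * (1 / (m : ℝ)) *
        Complex.re (kappaSum mbar m r fun r₁ m₁ r₂ m₂ i =>
          (((i : ℝ) ^ 2 * Δ₁ ^ (i - 1) * gammaTr ε G0 γ m₁ r₁ * gammaTr ε G0 γ m₂ r₂ : ℝ) : ℂ)) :=
  Iff.rfl

/-- `γ̃ ≥ 0` once `γ_{m r} ≥ 0` for `m > 4`. [cite: Salmhofer1998, Theorem 1 (4.17) (p.15 L41–47)] -/
theorem gammaTr_nonneg {ε : ℝ} (hε : 0 ≤ ε) (G0 : (m : ℕ) → ℕ → (Fin m → Γ) → ℂ) (γ : ℕ → ℕ → ℝ)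
    {m r : ℕ} (h : 4 < m → 0 ≤ γ m r) : 0 ≤ gammaTr ε G0 γ m r := by
  unfold gammaTr
  split_ifs with h1 h2 h3
  · exact le_rfl
  · exact kernelNorm_nonneg hε _ _
  · exact le_rfl
  · exact h (by omega)

/-- The norm of a frozen factor against `γ̃ e^{t(m/2-2)}` (the inductive hypothesis (4.16) for the
factors of `∫dκ̃`; at four legs `e^{0} = 1`, below four legs both sides vanish).
[cite: Salmhofer1998, Theorem 1 proof (p.15 L55–62)] -/
theorem sNorm_truncFactor_le {ε : ℝ} (G : KernelFamily Γ) (γ : ℕ → ℕ → ℝ) {m r : ℕ} (t : ℝ)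
    (hm2 : m % 2 = 0)
    (hIH : 6 ≤ m → sNorm ε (G m r t) ≤ γ m r * Real.exp (t * ((m : ℝ) / 2 - 2))) :
    sNorm ε (truncFactor G m r t) ≤
      gammaTr ε (fun m r X => G m r 0 X) γ m r * Real.exp (t * ((m : ℝ) / 2 - 2)) := by
  unfold gammaTr
  by_cases hlt : m < 4
  · have h0 : truncFactor G m r t = 0 := funext fun X => truncFactor_apply_of_lt G hlt r t X
    rw [h0, if_pos hlt, zero_mul]
    unfold sNorm
    rw [kernelNorm_zero_kernel]
  rw [if_neg hlt]
  by_cases h4 : m = 4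
  · subst h4
    rw [if_pos rfl]
    have e : Real.exp (t * (((4 : ℕ) : ℝ) / 2 - 2)) = 1 := by norm_num
    rw [e, mul_one]
    by_cases hr : r = 1
    · subst hr
      have h1 : truncFactor G 4 1 t = G 4 1 0 := funext fun X => by rw [truncFactor_apply_four, if_pos rfl]
      rw [h1, if_pos rfl]
    · have h0 : truncFactor G 4 r t = 0 := funext fun X => by
        rw [truncFactor_apply_four, if_neg hr, Pi.zero_apply]
      rw [h0, if_neg hr]
      unfold sNorm
      rw [kernelNorm_zero_kernel]
  · rw [if_neg h4]
    have hgt : 4 < m := by omega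
    have h1 : truncFactor G m r t = G m r t := funext fun X => truncFactor_apply_of_gt G hgt r t X
    rw [h1]
    exact hIH (by omega)

omit [Fintype Γ] [DecidableEq Γ] in
/-- Continuity in `t` of the frozen factors from that of the Green functions.
[cite: Salmhofer1998, Theorem 1 (p.15 L26–29)] -/
theorem continuousOn_truncFactor (G : KernelFamily Γ) {r : ℕ} {S : Set ℝ}
    (h : ∀ (m : ℕ) (U : Fin m → Γ), ContinuousOn (fun s => G m r s U) S) (m : ℕ) (U : Fin m → Γ) :
    ContinuousOn (fun s => truncFactor G m r s U) S := by
  by_cases hlt : m < 4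
  · have e : (fun s => truncFactor G m r s U) = fun _ => 0 := funext fun s => truncFactor_apply_of_lt G hlt r s U
    rw [e]
    exact continuousOn_const
  by_cases h4 : m = 4
  · subst h4
    have e : (fun s => truncFactor G 4 r s U) = fun _ => if r = 1 then G 4 1 0 U else 0 :=
      funext fun s => truncFactor_apply_four G r s U
    rw [e]
    exact continuousOn_const
  · have hgt : 4 < m := by omega
    have e : (fun s => truncFactor G m r s U) = fun s => G m r s U :=
      funext fun s => truncFactor_apply_of_gt G hgt r s U
    rw [e]
    exact h m U

end Trunc

/-! ### Regularity in the flow parameter: the integrand of the integral equation is integrable -/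

section Regularity

variable {Γ : Type*} [Fintype Γ] [DecidableEq Γ]

omit [Fintype Γ] [DecidableEq Γ] in
/-- `s ↦ det 𝒟_s^{(i)}(Y,Z)` is continuous when `s ↦ D_s(X,X')` is. [cite: Salmhofer1998, Proposition 2 (p.12 L104–106)] -/
theorem continuous_det_covMatrix {D : ℝ → Γ → Γ → ℂ} (hD : ∀ X X', Continuous fun s => D s X X')
    {i : ℕ} (Y Z : Fin i → Γ) : Continuous fun s => (covMatrix (D s) Y Z).det :=
  (continuous_matrix fun k l => by simpa [covMatrix] using hD (Y k) (Z l)).matrix_det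

omit [DecidableEq Γ] in
/-- Integrability on `[0,b]` of `s ↦` (the `(r₁,m₁,r₂,m₂,i)` summand of `Q_{m,r}(s | Y)`), given `D`
continuous, `Ḋ` integrable and the two factors continuous on `[0,b]`.
[cite: Salmhofer1998, Theorem 1 proof (p.15 L62–70)] -/
theorem intervalIntegrable_summand (ε : ℝ) {D Ddot : ℝ → Γ → Γ → ℂ} {T₁ T₂ : KernelFamily Γ} {b : ℝ}
    (hD : ∀ X X', Continuous fun s => D s X X')
    (hDdot : ∀ V W, IntervalIntegrable (fun s => Ddot s V W) volume 0 b)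
    (r₁ m₁ r₂ m₂ i m : ℕ)
    (hT₁ : ∀ U : Fin m₁ → Γ, ContinuousOn (fun s => T₁ m₁ r₁ s U) (Set.uIcc 0 b))
    (hT₂ : ∀ U : Fin m₂ → Γ, ContinuousOn (fun s => T₂ m₂ r₂ s U) (Set.uIcc 0 b)) (Y : Fin m → Γ) :
    IntervalIntegrable (fun s => summand ε D Ddot T₁ T₂ s r₁ m₁ r₂ m₂ i m Y) volume 0 b := by
  unfold summand
  by_cases h : i ≤ m₁ ∧ i ≤ m₂ ∧ m₁ + m₂ = m + 2 * i
  · simp only [dif_pos h]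
    unfold gInt
    refine ((ii_finset_sum _ fun VW _ => ?_).const_mul _).const_mul _
    refine (hDdot (VW 0) (VW 1)).mul_continuousOn ?_
    refine continuousOn_const.mul (continuousOn_finsetSum _ fun Y' _ => ?_)
    refine continuousOn_const.mul (continuousOn_finsetSum _ fun Z _ => ?_)
    exact (((continuous_det_covMatrix hD Y' Z).continuousOn).mul (hT₁ _)).mul (hT₂ _)
  · simp only [dif_neg h]
    exact intervalIntegrable_const

omit [DecidableEq Γ] in
/-- Integrability on `[0,b]` of `s ↦ Q̃_{m,r}(s | Y)`, given `D` continuous, `Ḋ` integrable and all factors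
of lower order continuous on `[0,b]`. [cite: Salmhofer1998, Theorem 1 proof (p.15 L62–70)] -/
theorem intervalIntegrable_quadTerm (ε : ℝ) (mbar : ℕ → ℕ) {D Ddot : ℝ → Γ → Γ → ℂ} {T : KernelFamily Γ}
    {b : ℝ} (hD : ∀ X X', Continuous fun s => D s X X')
    (hDdot : ∀ V W, IntervalIntegrable (fun s => Ddot s V W) volume 0 b) (m r : ℕ)
    (hT : ∀ r' < r, ∀ (m' : ℕ) (U : Fin m' → Γ), ContinuousOn (fun s => T m' r' s U) (Set.uIcc 0 b))
    (Y : Fin m → Γ) :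
    IntervalIntegrable (fun s => quadTerm ε mbar D Ddot T T m r s Y) volume 0 b := by
  simp only [quadTerm_eq_kappaSum_summand, kappaSum]
  refine ii_finset_sum _ fun r₁ hr₁ => ii_finset_sum _ fun m₁ _ =>
    ii_finset_sum _ fun m₂ _ => ii_finset_sum _ fun i _ => ?_
  have hr1 : r₁ < r := by simp only [Finset.mem_Icc] at hr₁; omega
  have hr2 : r - r₁ < r := by simp only [Finset.mem_Icc] at hr₁; omega
  by_cases hM : MIndex mbar r₁ (r - r₁) m m₁ m₂ i = true
  · simp only [hM, if_true]
    exact (intervalIntegrable_summand ε hD hDdot r₁ m₁ (r - r₁) m₂ i m (hT r₁ hr1 m₁) (hT (r - r₁) hr2 m₂)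
      Y).const_mul _
  · simp only [hM]
    simp

end Regularity

/-! ### Theorem 1 -/

section Main

-- `Γ : Type` (not `Type*`): the named facts `DeterminantNormBound` / `TruncatedPowerCounting` quantify
-- over `Type`.
variable {Γ : Type} [Fintype Γ] [DecidableEq Γ]

/-- The per-index algebra of the induction step: with `m₁ + m₂ = m + 2i`,
`i² (Δ₁e^{-s})^{i-1} · Δ₂e^{s} · γ₁e^{s(m₁/2-2)} · γ₂e^{s(m₂/2-2)} = e^{s(m/2-2)} Δ₂ · i² Δ₁^{i-1} γ₁ γ₂`
("by … `m₁ + m₂ - 2i = m`", p.15 L62–66). [cite: Salmhofer1998, Theorem 1 proof (p.15 L55–66)] -/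
theorem step_exponent_identity {m m₁ m₂ i : ℕ} (hi : 1 ≤ i) (hsum : m₁ + m₂ = m + 2 * i)
    (Δ₁ Δ₂ g₁ g₂ s : ℝ) :
    (i : ℝ) ^ 2 * (Δ₁ * Real.exp (-s)) ^ (i - 1) * (Δ₂ * Real.exp s) *
        (g₁ * Real.exp (s * ((m₁ : ℝ) / 2 - 2))) * (g₂ * Real.exp (s * ((m₂ : ℝ) / 2 - 2))) =
      Real.exp (s * ((m : ℝ) / 2 - 2)) * Δ₂ * ((i : ℝ) ^ 2 * Δ₁ ^ (i - 1) * g₁ * g₂) := by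
  have e1 : (Real.exp (-s)) ^ (i - 1) = Real.exp (((i - 1 : ℕ) : ℝ) * (-s)) := (Real.exp_nat_mul _ _).symm
  have hi' : ((i - 1 : ℕ) : ℝ) = (i : ℝ) - 1 := by rw [Nat.cast_sub hi, Nat.cast_one]
  have hsum' : (m₁ : ℝ) + m₂ = m + 2 * i := by exact_mod_cast hsum
  have e2 : Real.exp (((i : ℝ) - 1) * -s) * Real.exp s * Real.exp (s * ((m₁ : ℝ) / 2 - 2)) *
      Real.exp (s * ((m₂ : ℝ) / 2 - 2)) = Real.exp (s * ((m : ℝ) / 2 - 2)) := by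
    rw [← Real.exp_add, ← Real.exp_add, ← Real.exp_add]
    congr 1
    linear_combination (s / 2) * hsum'
  rw [mul_pow, e1, hi']
  calc (i : ℝ) ^ 2 * (Δ₁ ^ (i - 1) * Real.exp (((i : ℝ) - 1) * -s)) * (Δ₂ * Real.exp s) *
        (g₁ * Real.exp (s * ((m₁ : ℝ) / 2 - 2))) * (g₂ * Real.exp (s * ((m₂ : ℝ) / 2 - 2)))
      = ((i : ℝ) ^ 2 * Δ₁ ^ (i - 1) * Δ₂ * g₁ * g₂) * (Real.exp (((i : ℝ) - 1) * -s) * Real.exp s *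
          Real.exp (s * ((m₁ : ℝ) / 2 - 2)) * Real.exp (s * ((m₂ : ℝ) / 2 - 2))) := by ring
    _ = ((i : ℝ) ^ 2 * Δ₁ ^ (i - 1) * Δ₂ * g₁ * g₂) * Real.exp (s * ((m : ℝ) / 2 - 2)) := by rw [e2]
    _ = _ := by ring

/-- **Theorem 1, abstract form**: the induction of p.15 L48–85 for an arbitrary finite `Γ`, a covariance
`D_t` continuous in `t` with measurable, locally bounded derivative `Ḋ_t`, determinant bound
`|det 𝒟_s^{(i)}| ≤ (Δ₁e^{-s})^i` (Lemma 2 with (4.14)) and `‖Ḋ_s‖ ≤ Δ₂e^{s}` ((4.15)).  The conclusion packages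
the three statements carried through the induction on `r`: `γ_{mr} ≥ 0`, continuity of `s ↦ G̃_{mr}(s|X)`
on `[0,∞)`, and the bounds (4.16). [cite: Salmhofer1998, Theorem 1 (p.15 L12–85)] -/
theorem truncatedPowerCounting_core {ε : ℝ} (hε : 0 < ε) (mbar : ℕ → ℕ) {D Ddot : ℝ → Γ → Γ → ℂ}
    {Δ₁ Δ₂ : ℝ} (hΔ₁ : 0 ≤ Δ₁) (hΔ₂ : 0 ≤ Δ₂)
    (hDc : ∀ X X', Continuous fun s => D s X X')
    (hDdot : ∀ (V W : Γ) (b : ℝ), 0 ≤ b → IntervalIntegrable (fun s => Ddot s V W) volume 0 b)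
    (hdet : ∀ s : ℝ, 0 ≤ s → ∀ (i : ℕ) (Y Z : Fin i → Γ),
      ‖(covMatrix (D s) Y Z).det‖ ≤ (Δ₁ * Real.exp (-s)) ^ i)
    (h15 : ∀ s : ℝ, 0 ≤ s → sNorm ε (twoPt (Ddot s)) ≤ Δ₂ * Real.exp s)
    (G : KernelFamily Γ) (γ : ℕ → ℕ → ℝ) (hG : IsTruncatedRGESolution ε mbar D Ddot G)
    (hΓ : IsTruncatedGamma ε mbar (fun m r X => G m r 0 X) Δ₁ Δ₂ γ) (r : ℕ) :
    (∀ m, 0 ≤ γ m r) ∧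
    (∀ (m : ℕ) (X : Fin m → Γ) (b : ℝ), 0 ≤ b → ContinuousOn (fun s => G m r s X) (Set.Icc 0 b)) ∧
    (∀ (m : ℕ) (t : ℝ), 0 ≤ t →
      (6 ≤ m → sNorm ε (G m r t) ≤ γ m r * Real.exp (t * ((m : ℝ) / 2 - 2))) ∧
      (m = 4 → sNorm ε (G m r t) ≤ γ m r * (1 + t)) ∧
      (m = 2 → sNorm ε (G m r t) ≤ γ m r)) := by
  rw [isTruncatedGamma_iff] at hΓ
  induction r using Nat.strong_induction_on with
  | _ r IH => ?_
  set gtr := gammaTr ε (fun m r X => G m r 0 X) γ with hgtr_def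
  -- the factors of lower order: `γ̃ ≥ 0`, norm bounds, continuity
  have hgtr0 : ∀ r' < r, ∀ m', 0 ≤ gtr m' r' := fun r' hr' m' =>
    gammaTr_nonneg hε.le _ γ fun _ => (IH r' hr').1 m'
  have hTnorm : ∀ r' < r, ∀ (m' : ℕ) (s : ℝ), 0 ≤ s → m' % 2 = 0 →
      sNorm ε (truncFactor G m' r' s) ≤ gtr m' r' * Real.exp (s * ((m' : ℝ) / 2 - 2)) :=
    fun r' hr' m' s hs hm2 => sNorm_truncFactor_le G γ s hm2 ((IH r' hr').2.2 m' s hs).1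
  have hTcont : ∀ (b : ℝ), 0 ≤ b → ∀ r' < r, ∀ (m' : ℕ) (U : Fin m' → Γ),
      ContinuousOn (fun s => truncFactor G m' r' s U) (Set.uIcc 0 b) := fun b hb r' hr' =>
    continuousOn_truncFactor G fun m' U => by
      rw [Set.uIcc_of_le hb]; exact (IH r' hr').2.1 m' U b hb
  -- integrability of the integrand of the integral equation at order `r`
  have hq : ∀ (m : ℕ) (Y : Fin m → Γ) (b : ℝ), 0 ≤ b →
      IntervalIntegrable (fun s => quadTerm ε mbar D Ddot (truncFactor G) (truncFactor G) m r s Y)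
        volume 0 b := fun m Y b hb =>
    intervalIntegrable_quadTerm ε mbar hDc (fun V W => hDdot V W b hb) m r (hTcont b hb) Y
  -- the constant `K₀ = Re ∫dκ̃ i² Δ₁^{i-1} γ̃ γ̃` of (4.17) and its sign
  have hK0 : ∀ m, 0 ≤ (kappaSum mbar m r fun r₁ m₁ r₂ m₂ i =>
      (((i : ℝ) ^ 2 * Δ₁ ^ (i - 1) * gtr m₁ r₁ * gtr m₂ r₂ : ℝ) : ℂ)).re := by
    intro m
    refine re_kappaSum_nonneg mbar m r _ fun r₁ m₁ m₂ i hr₁ _ _ _ _ _ => ?_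
    have hr1 : r₁ < r := by simp only [Finset.mem_Icc] at hr₁; omega
    have hr2 : r - r₁ < r := by simp only [Finset.mem_Icc] at hr₁; omega
    exact mul_nonneg (mul_nonneg (mul_nonneg (sq_nonneg _) (pow_nonneg hΔ₁ _)) (hgtr0 r₁ hr1 m₁))
      (hgtr0 (r - r₁) hr2 m₂)
  refine ⟨fun m => ?_, fun m X b hb => ?_, fun m t ht => ?_⟩
  · -- `γ_{mr} ≥ 0`
    rw [hΓ m r]
    exact add_nonneg (kernelNorm_nonneg hε.le _ _)
      (mul_nonneg (mul_nonneg (mul_nonneg (by norm_num) hΔ₂) (by positivity)) (hK0 m))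
  · -- continuity of `s ↦ G̃_{mr}(s | X)` on `[0,b]`, from the integral equation
    have hF : ∀ π : Equiv.Perm (Fin m), ContinuousOn (fun s => ∫ u in (0 : ℝ)..s,
        quadTerm ε mbar D Ddot (truncFactor G) (truncFactor G) m r u (X ∘ π)) (Set.Icc 0 b) := by
      intro π
      have := intervalIntegral.continuousOn_primitive_interval' (hq m (X ∘ π) b hb) Set.left_mem_uIcc
      rwa [Set.uIcc_of_le hb] at this
    have hS : ContinuousOn (fun s => ∑ π : Equiv.Perm (Fin m), ((Equiv.Perm.sign π : ℤ) : ℂ) *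
        ∫ u in (0 : ℝ)..s, quadTerm ε mbar D Ddot (truncFactor G) (truncFactor G) m r u (X ∘ π))
        (Set.Icc 0 b) :=
      continuousOn_finsetSum _ fun π _ => continuousOn_const.mul (hF π)
    have hrhs : ContinuousOn (fun s => G m r 0 X + (2 : ℂ)⁻¹ * (((m.factorial : ℝ)⁻¹ : ℝ) •
        ∑ π : Equiv.Perm (Fin m), ((Equiv.Perm.sign π : ℤ) : ℂ) *
          ∫ u in (0 : ℝ)..s, quadTerm ε mbar D Ddot (truncFactor G) (truncFactor G) m r u (X ∘ π)))
        (Set.Icc 0 b) :=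
      continuousOn_const.add (continuousOn_const.mul (hS.fun_const_smul _))
    exact hrhs.congr fun s hs => by rw [hG m r s hs.1 X]; rfl
  · -- the bounds (4.16)
    rcases Nat.eq_zero_or_pos m with rfl | hmpos
    · exact ⟨fun h => absurd h (by norm_num), fun h => absurd h (by norm_num), fun h => absurd h (by norm_num)⟩
    obtain ⟨n, rfl⟩ : ∃ n, m = n + 1 := ⟨m - 1, by omega⟩
    set K₀ := (kappaSum mbar (n + 1) r fun r₁ m₁ r₂ m₂ i =>
      (((i : ℝ) ^ 2 * Δ₁ ^ (i - 1) * gtr m₁ r₁ * gtr m₂ r₂ : ℝ) : ℂ)).re with hK₀_def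
    have hK₀ : 0 ≤ K₀ := hK0 (n + 1)
    have hγ : γ (n + 1) r = sNorm ε (G (n + 1) r 0) + 3 * Δ₂ * (1 / ((n + 1 : ℕ) : ℝ)) * K₀ := hΓ (n + 1) r
    have hN0 : 0 ≤ sNorm ε (G (n + 1) r 0) := kernelNorm_nonneg hε.le _ _
    -- the slice bound `b(s) = e^{s(m/2-2)} Δ₂ K₀` from Lemma 1, Lemma 2, (4.14), (4.15) and the IH
    have hqb : ∀ s ∈ Set.Icc (0 : ℝ) t, ∀ (p : Fin (n + 1)) (x : Γ),
        ε ^ n * sliceSum (quadTerm ε mbar D Ddot (truncFactor G) (truncFactor G) (n + 1) r s) p x ≤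
          Real.exp (s * (((n + 1 : ℕ) : ℝ) / 2 - 2)) * (Δ₂ * K₀) := by
      intro s hs p x
      have hs0 : 0 ≤ s := hs.1
      refine (mul_sliceSum_le_kernelNorm ε _ p x).trans ?_
      have L1 := DeterminantNormBound_holds Γ ε hε mbar D Ddot (truncFactor G) (truncFactor G)
        (fun i s => (Δ₁ * Real.exp (-s)) ^ i) s (hdet s hs0) (n + 1) r (by omega)
      refine L1.trans ?_
      calc (kappaSum mbar (n + 1) r fun r₁ m₁ r₂ m₂ i =>
              (((i : ℝ) ^ 2 * (Δ₁ * Real.exp (-s)) ^ (i - 1) * sNorm ε (twoPt (Ddot s)) *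
                sNorm ε (truncFactor G m₁ r₁ s) * sNorm ε (truncFactor G m₂ r₂ s) : ℝ) : ℂ)).re
          ≤ (kappaSum mbar (n + 1) r fun r₁ m₁ r₂ m₂ i =>
              (((i : ℝ) ^ 2 * (Δ₁ * Real.exp (-s)) ^ (i - 1) * (Δ₂ * Real.exp s) *
                (gtr m₁ r₁ * Real.exp (s * ((m₁ : ℝ) / 2 - 2))) *
                (gtr m₂ r₂ * Real.exp (s * ((m₂ : ℝ) / 2 - 2))) : ℝ) : ℂ)).re := by
            refine re_kappaSum_mono mbar (n + 1) r _ _ fun r₁ m₁ m₂ i hr₁ _ _ hM _ _ => ?_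
            have hr1 : r₁ < r := by simp only [Finset.mem_Icc] at hr₁; omega
            have hr2 : r - r₁ < r := by simp only [Finset.mem_Icc] at hr₁; omega
            have hsp := MIndex_spec hM
            have hc0 : 0 ≤ (i : ℝ) ^ 2 * (Δ₁ * Real.exp (-s)) ^ (i - 1) :=
              mul_nonneg (sq_nonneg _) (pow_nonneg (mul_nonneg hΔ₁ (Real.exp_pos _).le) _)
            have hN₁0 : 0 ≤ sNorm ε (truncFactor G m₁ r₁ s) := kernelNorm_nonneg hε.le _ _
            have hN₂0 : 0 ≤ sNorm ε (truncFactor G m₂ (r - r₁) s) := kernelNorm_nonneg hε.le _ _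
            refine mul_le_mul (mul_le_mul (mul_le_mul_of_nonneg_left (h15 s hs0) hc0)
              (hTnorm r₁ hr1 m₁ s hs0 hsp.2.2.2.2.2.2.1) hN₁0 (mul_nonneg hc0 (by positivity)))
              (hTnorm (r - r₁) hr2 m₂ s hs0 hsp.2.2.2.2.2.2.2) hN₂0 ?_
            exact mul_nonneg (mul_nonneg hc0 (by positivity))
              (mul_nonneg (hgtr0 r₁ hr1 m₁) (Real.exp_pos _).le)
        _ = (kappaSum mbar (n + 1) r fun r₁ m₁ r₂ m₂ i =>
              ((Real.exp (s * (((n + 1 : ℕ) : ℝ) / 2 - 2)) * Δ₂ *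
                ((i : ℝ) ^ 2 * Δ₁ ^ (i - 1) * gtr m₁ r₁ * gtr m₂ r₂) : ℝ) : ℂ)).re := by
            refine re_kappaSum_congr mbar (n + 1) r _ _ fun r₁ m₁ m₂ i _ _ _ hM _ _ => ?_
            have hsp := MIndex_spec hM
            exact step_exponent_identity hsp.1 hsp.2.2.2.2.2.1 Δ₁ Δ₂ _ _ s
        _ = Real.exp (s * (((n + 1 : ℕ) : ℝ) / 2 - 2)) * Δ₂ * K₀ := by
            rw [hK₀_def, ← re_kappaSum_const_mul]
        _ = Real.exp (s * (((n + 1 : ℕ) : ℝ) / 2 - 2)) * (Δ₂ * K₀) := by ring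
    -- one step of the integral equation
    have hstep := kernelNorm_step_le hε (G (n + 1) r t) (G (n + 1) r 0)
      (fun s Y => quadTerm ε mbar D Ddot (truncFactor G) (truncFactor G) (n + 1) r s Y)
      (fun s => Real.exp (s * (((n + 1 : ℕ) : ℝ) / 2 - 2)) * (Δ₂ * K₀)) ht
      (fun X => hG (n + 1) r t ht X) (fun Y => hq (n + 1) Y t ht)
      ((by fun_prop : Continuous fun s : ℝ => Real.exp (s * (((n + 1 : ℕ) : ℝ) / 2 - 2)) *
        (Δ₂ * K₀)).intervalIntegrable 0 t)
      (fun s _ => mul_nonneg (Real.exp_pos _).le (mul_nonneg hΔ₂ hK₀)) hqb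
    rw [intervalIntegral.integral_mul_const] at hstep
    change sNorm ε (G (n + 1) r t) ≤ sNorm ε (G (n + 1) r 0) +
      2⁻¹ * ((∫ s in (0 : ℝ)..t, Real.exp (s * (((n + 1 : ℕ) : ℝ) / 2 - 2))) * (Δ₂ * K₀)) at hstep
    refine ⟨fun hm6 => ?_, fun hm4 => ?_, fun hm2 => ?_⟩
    · -- `m ≥ 6`: `½ ∫_0^t e^{s(m/2-2)} ≤ (1/(m-4)) e^{t(m/2-2)} ≤ (3/m) e^{t(m/2-2)}`
      have hm6' : (6 : ℝ) ≤ ((n + 1 : ℕ) : ℝ) := by exact_mod_cast hm6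
      set a : ℝ := ((n + 1 : ℕ) : ℝ) / 2 - 2 with ha_def
      have ha : 0 < a := by rw [ha_def]; linarith
      have hI : ∫ s in (0 : ℝ)..t, Real.exp (s * a) = (Real.exp (t * a) - 1) / a := integral_exp_mul ha.ne' t
      rw [hI] at hstep
      have hexp1 : 1 ≤ Real.exp (t * a) := Real.one_le_exp (mul_nonneg ht ha.le)
      have hC : 0 ≤ Δ₂ * K₀ := mul_nonneg hΔ₂ hK₀
      have h1 : 2⁻¹ * ((Real.exp (t * a) - 1) / a * (Δ₂ * K₀)) ≤
          2⁻¹ * (Real.exp (t * a) / a * (Δ₂ * K₀)) :=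
        mul_le_mul_of_nonneg_left (mul_le_mul_of_nonneg_right
          (div_le_div_of_nonneg_right (by linarith) ha.le) hC) (by norm_num)
      have h2 : 2⁻¹ * (Real.exp (t * a) / a * (Δ₂ * K₀)) =
          (1 / (2 * a)) * (Δ₂ * K₀) * Real.exp (t * a) := by
        field_simp
      have h3 : 1 / (2 * a) ≤ 3 * (1 / ((n + 1 : ℕ) : ℝ)) := by
        have hM : (0 : ℝ) < ((n + 1 : ℕ) : ℝ) := by positivity
        rw [show 3 * (1 / ((n + 1 : ℕ) : ℝ)) = 3 / ((n + 1 : ℕ) : ℝ) by ring,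
          div_le_div_iff₀ (by positivity) hM, ha_def]
        linarith
      calc sNorm ε (G (n + 1) r t)
          ≤ sNorm ε (G (n + 1) r 0) + (1 / (2 * a)) * (Δ₂ * K₀) * Real.exp (t * a) := by
            linarith [hstep, h1, h2]
        _ ≤ sNorm ε (G (n + 1) r 0) * Real.exp (t * a) +
            3 * (1 / ((n + 1 : ℕ) : ℝ)) * (Δ₂ * K₀) * Real.exp (t * a) := by
            have := mul_le_mul_of_nonneg_right h3 (mul_nonneg hC (Real.exp_pos (t * a)).le)
            nlinarith [hN0, hexp1, this]
        _ = γ (n + 1) r * Real.exp (t * a) := by rw [hγ]; ring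
    · -- `m = 4`: `½ ∫_0^t ds ≤ (3/4)(1+t)`
      obtain rfl : n = 3 := by omega
      have ha : (((3 + 1 : ℕ) : ℝ) / 2 - 2) = 0 := by norm_num
      have hI : ∫ s in (0 : ℝ)..t, Real.exp (s * (((3 + 1 : ℕ) : ℝ) / 2 - 2)) = t := by
        rw [ha]; simp
      rw [hI] at hstep
      have hC : 0 ≤ Δ₂ * K₀ := mul_nonneg hΔ₂ hK₀
      rw [hγ]
      have h4 : (1 / ((3 + 1 : ℕ) : ℝ)) = 1 / 4 := by norm_num
      rw [h4]
      nlinarith [hstep, mul_nonneg hN0 ht, mul_nonneg hC ht]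
    · -- `m = 2`: `½ ∫_0^t e^{-s} ≤ ½ ≤ 3/2`
      obtain rfl : n = 1 := by omega
      have ha : (((1 + 1 : ℕ) : ℝ) / 2 - 2) = -1 := by norm_num
      have hI : ∫ s in (0 : ℝ)..t, Real.exp (s * (((1 + 1 : ℕ) : ℝ) / 2 - 2)) =
          (Real.exp (t * (-1)) - 1) / (-1) := by
        rw [ha]; exact integral_exp_mul (by norm_num) t
      rw [hI] at hstep
      have hC : 0 ≤ Δ₂ * K₀ := mul_nonneg hΔ₂ hK₀
      have hexp : 0 ≤ Real.exp (t * (-1)) := (Real.exp_pos _).le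
      rw [hγ]
      have h2 : (1 / ((1 + 1 : ℕ) : ℝ)) = 1 / 2 := by norm_num
      rw [h2]
      nlinarith [hstep, mul_nonneg hC hexp]

/-- **Salmhofer 1998, Theorem 1** (power counting for the truncated flow, (4.16)–(4.17)), discharging the
named fact `TruncatedPowerCounting` (licence F-081): for `D_t` of the form (4.6) with (4.14), (4.15), the
truncated flow satisfies `‖G̃_{mr}(t)‖ ≤ γ_{mr} e^{t(m/2-2)}` (`m ≥ 6`), `≤ γ_{4r}(1+t)` (`m = 4`),
`≤ γ_{2r}` (`m = 2`).  Proof: `truncatedPowerCounting_core` with Lemma 2 (`CovarianceGramBound_holds`)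
supplying the determinant bound. [cite: Salmhofer1998, Theorem 1 (p.15 L12–85)] -/
theorem TruncatedPowerCounting_holds : TruncatedPowerCounting := by
  intro Λ _ _ _ Λs N _ _ _ χ neg εs Dhat M D Ddot ε mbar Δ₁ Δ₂ hε hDF hD h14 h15 G γ hG hΓ
  have hDc : ∀ X X' : Λ × N × Fin 2, Continuous fun s => D s X X' := fun X X' =>
    continuous_iff_continuousAt.mpr fun s => (hD s X X').continuousAt
  have hsum0 : ∀ s, 0 ≤ εs * ∑ k : Λs, ‖Dhat s k‖ := fun s =>
    mul_nonneg hDF.εs_pos.le (Finset.sum_nonneg fun _ _ => norm_nonneg _)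
  have hΔ₁ : 0 ≤ Δ₁ := by
    have h := h14 0 le_rfl
    rw [neg_zero, Real.exp_zero, mul_one] at h
    exact (hsum0 0).trans h
  have hΔ₂ : 0 ≤ Δ₂ := by
    have h := h15 0 le_rfl
    rw [Real.exp_zero, mul_one] at h
    exact (kernelNorm_nonneg hε.le _ _).trans h
  have hdet : ∀ s : ℝ, 0 ≤ s → ∀ (i : ℕ) (Y Z : Fin i → Λ × N × Fin 2),
      ‖(covMatrix (D s) Y Z).det‖ ≤ (Δ₁ * Real.exp (-s)) ^ i := by
    intro s hs i Y Z
    have h2 := (CovarianceGramBound_holds Λ Λs N χ neg εs Dhat M D hDF s).2 (i + 1) Y Z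
    have h3 : (εs * ∑ k : Λs, ‖Dhat s k‖) ^ (i + 1 - 1) ≤ (Δ₁ * Real.exp (-s)) ^ i := by
      rw [Nat.add_sub_cancel]
      exact pow_le_pow_left₀ (hsum0 s) (h14 s hs) i
    exact h2.trans h3
  have hDdot : ∀ (V W : Λ × N × Fin 2) (b : ℝ), 0 ≤ b →
      IntervalIntegrable (fun s => Ddot s V W) volume 0 b := by
    intro V W b hb
    have hmeas : AEStronglyMeasurable (fun s => Ddot s V W) (volume.restrict (Set.uIoc 0 b)) := by
      have e : (fun s => Ddot s V W) = deriv (fun s => D s V W) :=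
        funext fun s => ((hD s V W).deriv).symm
      rw [e]
      exact (measurable_deriv _).aestronglyMeasurable
    refine IntervalIntegrable.mono_fun' (g := fun _ => ε⁻¹ * (Δ₂ * Real.exp b)) intervalIntegrable_const
      hmeas ?_
    refine (ae_restrict_iff' measurableSet_uIoc).mpr (ae_of_all _ fun s hs => ?_)
    rw [Set.uIoc_of_le hb] at hs
    have hs0 : 0 ≤ s := hs.1.le
    calc ‖Ddot s V W‖ ≤ ∑ W' : Λ × N × Fin 2, ‖Ddot s V W'‖ :=
          Finset.single_le_sum (f := fun W' => ‖Ddot s V W'‖) (fun _ _ => norm_nonneg _) (Finset.mem_univ W)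
      _ ≤ (ε ^ 1)⁻¹ * kernelNorm ε 2 (twoPt (Ddot s)) := sum_norm_twoPt_fst_le hε (Ddot s) V
      _ ≤ ε⁻¹ * (Δ₂ * Real.exp b) := by
          rw [pow_one]
          refine mul_le_mul_of_nonneg_left ((h15 s hs0).trans ?_) (inv_nonneg.mpr hε.le)
          exact mul_le_mul_of_nonneg_left (Real.exp_le_exp.mpr hs.2) hΔ₂
  intro m r t ht
  exact (truncatedPowerCounting_core hε mbar hΔ₁ hΔ₂ hDc hDdot hdet h15 G γ hG hΓ r).2.2 m t ht

end Main

end Salmhofer1998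

end Literature.MathematicalPhysics.QuantumLattice.FermiRG
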